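import Mathlib
import HarnessLib
import Summits.NavierStokesRegularity.NavierStokesRegularity.Theses.PoloidalWindowDoor
import Summits.NavierStokesRegularity.NavierStokesRegularity.Theorems.PoloidalWindowDoorPoloidalWindowRigiditySharper
import Summits.NavierStokesRegularity.NavierStokesRegularity.Theorems.PoloidalWindowDoorPoloidalWindowRigidityFlat
import Summits.NavierStokesRegularity.NavierStokesRegularity.Theorems.PoloidalWindowDoorLrcModEntireIff
import Summits.NavierStokesRegularity.NavierStokesRegularity.Theorems.PoloidalWindowDoorLrcModEntireUntwistedGerm
import Summits.NavierStokesRegularity.NavierStokesRegularity.Theorems.PoloidalWindowDoorLrcModEntireTwistingTHLocalHypGerm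
import Summits.NavierStokesRegularity.NavierStokesRegularity.Theorems.PoloidalWindowDoorLrcModEntireTwistingTHLocalNonUmbilic
import Summits.NavierStokesRegularity.NavierStokesRegularity.Theorems.PoloidalWindowDoorLrcModEntireTwistingTHLocalGalilean
import Summits.NavierStokesRegularity.NavierStokesRegularity.Theorems.PoloidalWindowDoorLrcModEntireTwistingTHLocalNormalFormRS
import Summits.NavierStokesRegularity.NavierStokesRegularity.Theorems.PoloidalWindowDoorPoloidalWindowRigidityTimeShearClosed
import Summits.NavierStokesRegularity.NavierStokesRegularity.Theorems.PoloidalWindowDoorPoloidalWindowRigiditySymmetryGerms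
import Summits.NavierStokesRegularity.NavierStokesRegularity.Theorems.PoloidalWindowDoorPoloidalWindowRigidityVerticalShearGerm
import Summits.NavierStokesRegularity.NavierStokesRegularity.Theorems.LocalSineTubeDoorProfileAlignedWindowRigidityAncient
import Summits.NavierStokesRegularity.NavierStokesRegularity.Theorems.PoloidalWindowDoorLrcModEntireExtremalThread
import Summits.NavierStokesRegularity.NavierStokesRegularity.Theorems.PoloidalWindowDoorLrcModEntireThreadPins
import Summits.NavierStokesRegularity.NavierStokesRegularity.Theorems.PoloidalWindowDoorLrcModEntireThreadDichotomy

/-!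
# SKELETON twist_split v5 CANDIDATE for item `LrcModEntire` (stmt-NavierStokesRegularity-20428) = ns-idea-8's LINE 4 `far_thread` v4 with its three provable
# normal-form stubs DISCHARGED BY TREE THEOREMS (LEAD ns-poloidal-K2-p3 g10, 2026-08-28): S1 `stub_extremalThread` := `…LrcModEntireExtremalThread.extremalThread`
# (p629364), S2 `stub_threadDichotomy` := `…LrcModEntireThreadDichotomy.threadDichotomy` (p631307), S5 + thread pin := `…LrcModEntireThreadPins` (p631041).
# OPEN stubs (sorries) = {S0 `stub_localTHEmptyHypNUGRS` (shared R-TH column, = twist_split v4.3 VERBATIM; decider j301374), S3 `stub_threadedThickEmpty` (THICK column AT A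
# THREADED HOT SPOT)}.  Concludes `LrcModEntire_of_farThread : …Theses.PoloidalWindowDoor.LrcModEntire` AND `PoloidalWindowRigidity_of_farThread` by name.
# NOT REGISTERED at writing (CENSUS-20428-g10 v2 §6: waits for refuter1's K-READ of S3 and the director's word); text below = ns-idea-8's card v4 otherwise unchanged.
#
# SKELETON `far_thread` v4 (= v3 + `push_neg` lint fix; v3 = v2 + S5 `threadSignedPin` PROVED sorry-free; v2 = v1 + critic prices P1/P2 of idea-crit-7 g2 07:25:50Z: signed-pin statement (S5) consumed by S3; Morse/flat split = line `thread_axis`) — crux `PoloidalWindowRigidity` (K2, stmt-NavierStokesRegularity-19708; closes ALSO the promoted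
# stub `LrcModEntire`, stmt-NavierStokesRegularity-20428), route `PoloidalWindowDoor`, THICK column — ideator seat ns-idea-8 gen 2
# (lens «barrier»; files-only per KEY-NS #68/#69: NOT the skeleton of record; the K2 leads decide adoption).

LEVER (five words): **compactness recentring forces a thread.**  A «thread» of a class profile is a point of a horizontal plane where
the vertical velocity `w = v₂` is critical and non-zero (`∂₀v₂ = ∂₁v₂ = 0`, `v₂ ≠ 0`).  The move: the sub-class «Type-I ancient mild +
poloidal along e₃» is invariant under space translations and parabolic rescalings and COMPACT under KNSS limits (fields AND gradients
converge: tree `exists_tendsto_of_isTypeIAncientMild_seq`, `poloidal_of_tendsto`, `poloidal_translate`, `poloidal_nsRescale`), so a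
profile with `v₂ ≢ 0` can be recentred at near-maximisers of the scale-invariant size `√(−t)|v₂(t,x)|` and passed to the limit: the
limit profile ATTAINS that supremum at the hot spot `(−1, 0)` (`stub_extremalThread`).  A hot spot is a thread with extra free pins
(`∇v₂(−1,0) = 0`, `v₂·D²v₂(−1,0) ≤ 0`, `∂ₜv₂ = v₂/2` there) — proved below from the normalisation (`threadPin_of_hotSpot`).  The limit may
leave the thick stratum, so EVERY column must be consumed in LIOUVILLE currency (`v ≡ 0`), which the tree provides for all columns but
two: untwisted (`stub_untwistedGerm` p560652 + `eq_zero_of_germ`), (TV) (`timeShear_normalForm` + `eq_zero_of_timeShear_liminf` /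
`eq_zero_of_timeShear_unbounded`), degenerate open germs (`eq_zero_of_curl_eq_zero_on_open`, `eq_zero_of_horizontalGradient_eq_zero_on_open`,
`eq_zero_of_verticalShear_eq_zero_on_open`); the (TH)∩twisting column is the SHARED registered local stub `stub_localTHEmptyHypNUGRS`
(VERBATIM `twist_split` v4.3, item 20428) through the tree chain `…TwistingTHLocalHypGerm.stub_twistingTH_of_localEmptyHyp`; and the
THICK∩twisting column is THIS LINE's deciding stub, now pinned at a thread: `stub_threadedThickEmpty`.  The elementary point-dichotomy
`stub_threadDichotomy` (continuity of the Jacobian entries only) sorts the hot spot into exactly these five cases.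

COMPOSITION (kernel-checked, no sorry outside `stub_*`): `poloidalLiouville_of_farThread` (class + poloidal ⇒ `v ≡ 0`) ⇒
`PoloidalWindowRigidity_of_farThread : …Theses.PoloidalWindowDoor.PoloidalWindowRigidity` (via the landed reduction
`…Sharper.poloidalWindowRigidity_of_sliceSharpNonflatLiouville`) and `LrcModEntire_of_farThread : …Theses.PoloidalWindowDoor.LrcModEntire`.

WHY EASIER AT A THREAD (card §why-easier): in the THICK normal form (`w = v₂`, `u_h = ∇_hφ`, `φ_z = G(t,z,w)`, `Λ = G_w`, THICK ⇔ `G_ww ≠ 0`,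
leaves = level curves of `w` on horizontal planes = vortex lines) the leaf space PINCHES at a thread: `G(t,z,·)` is single-valued
real-analytic AT the interior critical value `w* = w(thread)`, and `w − w*` starts at order two, so every structure function
(`G`, the pressure head, the Bernoulli datum) enters the Taylor hierarchy at HALF RATE — one new coefficient per two orders of the jet of `w` —
while the equations (frozen law, incompressibility, vertical momentum with (M)) keep full rate: a strictly more over-determined hierarchy
than at a generic point (where cert-1's jets are passive to order 13), linear algebra per order, no ansatz.  Second engine at a
max-thread: the closed-leaf disc moments `𝒜(c) = |{w > c}|`, `T = ∮ ds/|∇w|`, `J = ∮ w_z²/|∇w| ds` with the exact twist slack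
`J·T ≥ 𝒜_z²` (equality iff the leaf is untwisted) and the disc-integrated vertical momentum, which closes on (`𝒜`, `J`, `G`, head).

WHAT THIS IS NOT: not a proof of Navier–Stokes regularity, of K2, or of the THICK column — a typed line with ONE research stub
(`stub_threadedThickEmpty`), two provable normal-form stubs and one shared registered stub; (M) and the Type-I class are kept in every
class-level stub (honours `Negative.poloidalWindowRigidity_false_without_mild`, K-47 `twisting_false_without_mild`, K-50 `thickProfile`).
bears_on LADDER-NS N0 (rung N0-LocalTubeDoorPoloidal), items 19708 / 20428.
-/

noncomputable section

set_option linter.dupNamespace false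
set_option linter.unusedVariables false

namespace Summit.NavierStokesRegularity.NavierStokesRegularity.Cruxes.PoloidalWindowRigidity.FarThread

open MeasureTheory Set Function Filter Topology Metric
open scoped RealInnerProductSpace InnerProductSpace Laplacian
open Literature.Analysis Literature.Analysis.FluidPDE
open Summit.NavierStokesRegularity.NavierStokesRegularity.Theses.PoloidalWindowDoor
open Summit.NavierStokesRegularity.NavierStokesRegularity.Theorems.LocalSineTubeDoorProfileAlignedWindowRigidityAncient
open Summit.NavierStokesRegularity.NavierStokesRegularity.Theorems.PoloidalWindowDoorLrcModEntireThreadPins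
open Summit.NavierStokesRegularity.NavierStokesRegularity.Theorems.PoloidalWindowDoorPoloidalWindowRigiditySharper
open Summit.NavierStokesRegularity.NavierStokesRegularity.Theorems.PoloidalWindowDoorPoloidalWindowRigidityFlat
open Summit.NavierStokesRegularity.NavierStokesRegularity.Theorems.PoloidalWindowDoorLrcModEntireIff
open Summit.NavierStokesRegularity.NavierStokesRegularity.Theorems.PoloidalWindowDoorLrcModEntireUntwistedGerm
open Summit.NavierStokesRegularity.NavierStokesRegularity.Theorems.PoloidalWindowDoorLrcModEntireTwistingTHLocalHypGerm
open Summit.NavierStokesRegularity.NavierStokesRegularity.Theorems.PoloidalWindowDoorLrcModEntireTwistingTHLocalNonUmbilic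
open Summit.NavierStokesRegularity.NavierStokesRegularity.Theorems.PoloidalWindowDoorLrcModEntireTwistingTHLocalGalilean
open Summit.NavierStokesRegularity.NavierStokesRegularity.Theorems.PoloidalWindowDoorLrcModEntireTwistingTHLocalNormalFormRS
open Summit.NavierStokesRegularity.NavierStokesRegularity.Theorems.PoloidalWindowDoorPoloidalWindowRigidityTimeShearPressure
open Summit.NavierStokesRegularity.NavierStokesRegularity.Theorems.PoloidalWindowDoorPoloidalWindowRigidityTimeShearLiminf
open Summit.NavierStokesRegularity.NavierStokesRegularity.Theorems.PoloidalWindowDoorPoloidalWindowRigidityHorizontalFlatPast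
open Summit.NavierStokesRegularity.NavierStokesRegularity.Theorems.PoloidalWindowDoorPoloidalWindowRigiditySymmetryGerms
open Summit.NavierStokesRegularity.NavierStokesRegularity.Theorems.PoloidalWindowDoorPoloidalWindowRigidityVerticalShearGerm
open Summit.NavierStokesRegularity.NavierStokesRegularity.Theorems.LocalSineTubeDoorProfileAlignedWindowRigidityAncient

/-! ## The stubs -/

/-- **SHARED STUB ((TH) column) — VERBATIM `stub_localTHEmptyHypNUGRS` of the skeleton of record `Cruxes/LrcModEntire/Lines/twist_split.lean`
v4.3 (ns-poloidal-K2-p3 g9; item stmt-NavierStokesRegularity-20428).**  The local hyperbolic (TH)∩twisting PDE system is empty at a non-umbilic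
rest point in the rotation/scaling gauge.  One landing closes it here and there.  (This line needs the (TH) column in LIOUVILLE currency — the
recentred profile is not known to be singular — which is exactly what the local statement gives through
`…TwistingTHLocalHypGerm.stub_twistingTH_of_localEmptyHyp` + `…LrcModEntireIff.eq_zero_of_germ`.) -/
theorem stub_localTHEmptyHypNUGRS :
    ∀ (u : ℝ → EuclideanSpace ℝ (Fin 3) → EuclideanSpace ℝ (Fin 3)) (μ A : ℝ → ℝ → ℝ)
      (U : Set (ℝ × EuclideanSpace ℝ (Fin 3))) (p₀ : ℝ × EuclideanSpace ℝ (Fin 3)),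
      IsOpen U → p₀ ∈ U →
      AnalyticOnNhd ℝ (Function.uncurry u) U →
      (∀ p ∈ U, AnalyticAt ℝ (Function.uncurry μ) (p.1, p.2 2)) →
      (∀ p ∈ U, AnalyticAt ℝ (Function.uncurry A) (p.1, p.2 2)) →
      (∀ p ∈ U, fderiv ℝ (u p.1) p.2 (EuclideanSpace.single 0 1) 1 = fderiv ℝ (u p.1) p.2 (EuclideanSpace.single 1 1) 0) →
      (∀ p ∈ U, fderiv ℝ (u p.1) p.2 (EuclideanSpace.single 0 1) 0 + fderiv ℝ (u p.1) p.2 (EuclideanSpace.single 1 1) 1 +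
        fderiv ℝ (u p.1) p.2 (EuclideanSpace.single 2 1) 2 = 0) →
      (∀ p ∈ U, ∀ b : Fin 3, b ≠ 2 →
        fderiv ℝ (u p.1) p.2 (EuclideanSpace.single 2 1) b =
          μ p.1 (p.2 2) * fderiv ℝ (u p.1) p.2 (EuclideanSpace.single b 1) 2) →
      (∀ p ∈ U,
        (1 - μ p.1 (p.2 2)) *
            (deriv (fun s => u s p.2 2) p.1 + fderiv ℝ (fun y => u p.1 y 2) p.2 (u p.1 p.2)
              - Δ (fun y => u p.1 y 2) p.2) =
          A p.1 (p.2 2) + (deriv (fun s => μ s (p.2 2)) p.1 - deriv (deriv (μ p.1)) (p.2 2)) * u p.1 p.2 2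
            + deriv (μ p.1) (p.2 2) / 2 * u p.1 p.2 2 ^ 2
            - 2 * deriv (μ p.1) (p.2 2) * fderiv ℝ (u p.1) p.2 (EuclideanSpace.single 2 1) 2) →
      fderiv ℝ (fun y => fderiv ℝ (u p₀.1) y (EuclideanSpace.single 2 1) 2) p₀.2 (EuclideanSpace.single 0 1) *
            fderiv ℝ (u p₀.1) p₀.2 (EuclideanSpace.single 1 1) 2 -
          fderiv ℝ (fun y => fderiv ℝ (u p₀.1) y (EuclideanSpace.single 2 1) 2) p₀.2 (EuclideanSpace.single 1 1) *
            fderiv ℝ (u p₀.1) p₀.2 (EuclideanSpace.single 0 1) 2 ≠ 0 →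
      μ p₀.1 (p₀.2 2) ≠ 0 → μ p₀.1 (p₀.2 2) ≠ 1 → deriv (μ p₀.1) (p₀.2 2) ≠ 0 →
      μ p₀.1 (p₀.2 2) < 0 →
      (fderiv ℝ (u p₀.1) p₀.2 (EuclideanSpace.single 0 1) 0 ≠ fderiv ℝ (u p₀.1) p₀.2 (EuclideanSpace.single 1 1) 1 ∨
        fderiv ℝ (u p₀.1) p₀.2 (EuclideanSpace.single 1 1) 0 ≠ 0) →
      u p₀.1 p₀.2 = 0 → 
      fderiv ℝ (u p₀.1) p₀.2 (EuclideanSpace.single 0 1) 2 = 0 →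
      fderiv ℝ (u p₀.1) p₀.2 (EuclideanSpace.single 1 1) 2 = 1 → False := by
  sorry

/-- **STUB S1 (provable, M): EXTREMAL RECENTRING — a poloidal class profile with `v₂ ≢ 0` has a companion in the SAME class (same
constant `C`), poloidal, whose scale-invariant vertical size `√(−t)|v₂(t,x)|` ATTAINS its supremum over the slab at the hot spot `(−1,0)`.**
Proof route (all ingredients in the tree): `N := sup √(−t)|v₂| ∈ (0, C]`; near-maximisers `(t_k, x_k)`; `v_k := λ_k v(λ_k² ·, x_k + λ_k ·)`,
`λ_k = √(−t_k)` (class and poloidality are invariant: `…PoloidalExtremal.poloidal_translate/poloidal_nsRescale`, `isTypeIAncientMild_of_class`);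
KNSS compactness `…SqueezeCycleExtremalElementExistsExtraction.exists_tendsto_of_isTypeIAncientMild_seq` (fields and gradients converge, so the
limit is poloidal: `poloidal_of_tendsto`); pointwise limits give `√(−t)|v'₂| ≤ N` everywhere and `|v'₂(−1,0)| = N`.  No minimality, no
ε-regularity.  A thread for free: `threadPin_of_hotSpot` below. -/
theorem stub_extremalThread :
    ∀ (C : ℝ) (v : ℝ → EuclideanSpace ℝ (Fin 3) → EuclideanSpace ℝ (Fin 3)),
      Literature.Analysis.FluidPDE.HasTypeITimeDecay C v →
      ContinuousOn (Function.uncurry v) (Set.Iio (0 : ℝ) ×ˢ Set.univ) →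
      (∀ s t : ℝ, s < t → t < 0 → ∀ x, v t x =
        Literature.Analysis.UnboundedOperators.heatExtension (v s) (t - s) x -
          Literature.Analysis.FluidPDE.oseenDuhamel 1 s v v t x) →
      (∀ t < 0, Literature.Analysis.FluidPDE.VectorCalculus.IsDivFree (v t)) →
      (∀ s < 0, ∀ y, ⟪Literature.Analysis.FluidPDE.curl (v s) y, EuclideanSpace.single 2 1⟫_ℝ = 0) →
      (∃ t₀ : ℝ, t₀ < 0 ∧ ∃ y₀ : EuclideanSpace ℝ (Fin 3), v t₀ y₀ 2 ≠ 0) →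
      ∃ v' : ℝ → EuclideanSpace ℝ (Fin 3) → EuclideanSpace ℝ (Fin 3),
        Literature.Analysis.FluidPDE.HasTypeITimeDecay C v' ∧
        ContinuousOn (Function.uncurry v') (Set.Iio (0 : ℝ) ×ˢ Set.univ) ∧
        (∀ s t : ℝ, s < t → t < 0 → ∀ x, v' t x =
          Literature.Analysis.UnboundedOperators.heatExtension (v' s) (t - s) x -
            Literature.Analysis.FluidPDE.oseenDuhamel 1 s v' v' t x) ∧
        (∀ t < 0, Literature.Analysis.FluidPDE.VectorCalculus.IsDivFree (v' t)) ∧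
        (∀ s < 0, ∀ y, ⟪Literature.Analysis.FluidPDE.curl (v' s) y, EuclideanSpace.single 2 1⟫_ℝ = 0) ∧
        v' (-1) 0 2 ≠ 0 ∧ (∀ t < 0, ∀ x, Real.sqrt (-t) * |v' t x 2| ≤ |v' (-1) 0 2|) :=
  Summit.NavierStokesRegularity.NavierStokesRegularity.Theorems.PoloidalWindowDoorLrcModEntireExtremalThread.extremalThread

/-- **STUB S2 (provable, M): THE POINT DICHOTOMY AT `z₀`** — continuity of the Jacobian entries and of the twist bracket on the slab
(`…K2OfLrcSlope.continuousOn_fderiv_entry`, `…ThmARelocation.continuousOn_twist`) only.  For a poloidal class profile and a point `z₀` of the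
backward slab, ONE of: (i) an open `W ⊆ slab` of non-degenerate TWISTING points which is THICK (the slope `∂₂v_b/∂_bv₂` is a function of
`(t, x₂)` on NO open subset) and ACCUMULATES at `z₀`; (ii) a non-degenerate UNTWISTED window; (iii) a non-degenerate, pinned, twisting (TH)
window; (iv) a window with TIME-ONLY slope; (v) an open DEGENERATE germ on one slice (irrotational / horizontally flat / vertically rigid).
Proof sketch: `O := slab ∩ {ND ∧ T ≠ 0}` is open; if `z₀ ∈ closure O` then (i) with `W = O` unless thickness fails on a sub-window (⇒ (iii),
or (iv) if its pin fails); else a ball about `z₀` misses `O`: a non-degenerate point in it gives (ii), otherwise the pointwise degenerate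
disjunction on the ball's `z₀.1`-slice splits into (v) by `…DegenerateSlice.forall_or_exists_open_of_pointwise_or`. -/
theorem stub_threadDichotomy :
    ∀ (C : ℝ) (v : ℝ → EuclideanSpace ℝ (Fin 3) → EuclideanSpace ℝ (Fin 3)),
      Literature.Analysis.FluidPDE.HasTypeITimeDecay C v →
      ContinuousOn (Function.uncurry v) (Set.Iio (0 : ℝ) ×ˢ Set.univ) →
      (∀ s t : ℝ, s < t → t < 0 → ∀ x, v t x =
        Literature.Analysis.UnboundedOperators.heatExtension (v s) (t - s) x -
          Literature.Analysis.FluidPDE.oseenDuhamel 1 s v v t x) →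
      (∀ t < 0, Literature.Analysis.FluidPDE.VectorCalculus.IsDivFree (v t)) →
      (∀ s < 0, ∀ y, ⟪Literature.Analysis.FluidPDE.curl (v s) y, EuclideanSpace.single 2 1⟫_ℝ = 0) →
      ∀ z₀ : ℝ × EuclideanSpace ℝ (Fin 3), z₀.1 < 0 →
        (∃ W : Set (ℝ × EuclideanSpace ℝ (Fin 3)), IsOpen W ∧ W ⊆ Set.Iio (0 : ℝ) ×ˢ Set.univ ∧
          (∀ z ∈ W, (Literature.Analysis.FluidPDE.curl (v z.1) z.2 ≠ 0 ∧
            (fderiv ℝ (v z.1) z.2 (EuclideanSpace.single 0 1) 2 ≠ 0 ∨ fderiv ℝ (v z.1) z.2 (EuclideanSpace.single 1 1) 2 ≠ 0) ∧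
            (fderiv ℝ (v z.1) z.2 (EuclideanSpace.single 2 1) 0 ≠ 0 ∨ fderiv ℝ (v z.1) z.2 (EuclideanSpace.single 2 1) 1 ≠ 0)) ∧
            (fderiv ℝ (fun x => fderiv ℝ (v z.1) x (EuclideanSpace.single 2 1) 2) z.2 (EuclideanSpace.single 0 1) *
                fderiv ℝ (v z.1) z.2 (EuclideanSpace.single 1 1) 2 -
              fderiv ℝ (fun x => fderiv ℝ (v z.1) x (EuclideanSpace.single 2 1) 2) z.2 (EuclideanSpace.single 1 1) *
                fderiv ℝ (v z.1) z.2 (EuclideanSpace.single 0 1) 2 ≠ 0)) ∧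
          (∀ m : ℝ → ℝ → ℝ, ∀ W₁ : Set (ℝ × EuclideanSpace ℝ (Fin 3)), W₁ ⊆ W → IsOpen W₁ → W₁.Nonempty →
            ∃ z ∈ W₁, ∃ b : Fin 3, b ≠ 2 ∧
              fderiv ℝ (v z.1) z.2 (EuclideanSpace.single 2 1) b ≠
                m z.1 (z.2 2) * fderiv ℝ (v z.1) z.2 (EuclideanSpace.single b 1) 2) ∧
          (∀ r : ℝ, 0 < r → (Metric.ball z₀ r ∩ W).Nonempty)) ∨
        (∃ W : Set (ℝ × EuclideanSpace ℝ (Fin 3)), IsOpen W ∧ W.Nonempty ∧ W ⊆ Set.Iio (0 : ℝ) ×ˢ Set.univ ∧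
          (∀ z ∈ W, (Literature.Analysis.FluidPDE.curl (v z.1) z.2 ≠ 0 ∧
            (fderiv ℝ (v z.1) z.2 (EuclideanSpace.single 0 1) 2 ≠ 0 ∨ fderiv ℝ (v z.1) z.2 (EuclideanSpace.single 1 1) 2 ≠ 0) ∧
            (fderiv ℝ (v z.1) z.2 (EuclideanSpace.single 2 1) 0 ≠ 0 ∨ fderiv ℝ (v z.1) z.2 (EuclideanSpace.single 2 1) 1 ≠ 0))) ∧
          (∀ z ∈ W, (fderiv ℝ (fun x => fderiv ℝ (v z.1) x (EuclideanSpace.single 2 1) 2) z.2 (EuclideanSpace.single 0 1) *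
                fderiv ℝ (v z.1) z.2 (EuclideanSpace.single 1 1) 2 -
              fderiv ℝ (fun x => fderiv ℝ (v z.1) x (EuclideanSpace.single 2 1) 2) z.2 (EuclideanSpace.single 1 1) *
                fderiv ℝ (v z.1) z.2 (EuclideanSpace.single 0 1) 2 = 0))) ∨
        (∃ W : Set (ℝ × EuclideanSpace ℝ (Fin 3)), IsOpen W ∧ W.Nonempty ∧ W ⊆ Set.Iio (0 : ℝ) ×ˢ Set.univ ∧
          (∀ z ∈ W, (Literature.Analysis.FluidPDE.curl (v z.1) z.2 ≠ 0 ∧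
            (fderiv ℝ (v z.1) z.2 (EuclideanSpace.single 0 1) 2 ≠ 0 ∨ fderiv ℝ (v z.1) z.2 (EuclideanSpace.single 1 1) 2 ≠ 0) ∧
            (fderiv ℝ (v z.1) z.2 (EuclideanSpace.single 2 1) 0 ≠ 0 ∨ fderiv ℝ (v z.1) z.2 (EuclideanSpace.single 2 1) 1 ≠ 0))) ∧
          (∀ m : ℝ → ℝ, ∀ W₁ : Set (ℝ × EuclideanSpace ℝ (Fin 3)), W₁ ⊆ W → IsOpen W₁ → W₁.Nonempty →
            ∃ z ∈ W₁, ∃ b : Fin 3, b ≠ 2 ∧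
              fderiv ℝ (v z.1) z.2 (EuclideanSpace.single 2 1) b ≠
                m z.1 * fderiv ℝ (v z.1) z.2 (EuclideanSpace.single b 1) 2) ∧
          (∀ z ∈ W, (fderiv ℝ (fun x => fderiv ℝ (v z.1) x (EuclideanSpace.single 2 1) 2) z.2 (EuclideanSpace.single 0 1) *
                fderiv ℝ (v z.1) z.2 (EuclideanSpace.single 1 1) 2 -
              fderiv ℝ (fun x => fderiv ℝ (v z.1) x (EuclideanSpace.single 2 1) 2) z.2 (EuclideanSpace.single 1 1) *
                fderiv ℝ (v z.1) z.2 (EuclideanSpace.single 0 1) 2 ≠ 0)) ∧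
          (∃ m : ℝ → ℝ → ℝ, ∀ z ∈ W, ∀ b : Fin 3, b ≠ 2 →
            fderiv ℝ (v z.1) z.2 (EuclideanSpace.single 2 1) b =
              m z.1 (z.2 2) * fderiv ℝ (v z.1) z.2 (EuclideanSpace.single b 1) 2)) ∨
        (∃ W : Set (ℝ × EuclideanSpace ℝ (Fin 3)), IsOpen W ∧ W.Nonempty ∧ W ⊆ Set.Iio (0 : ℝ) ×ˢ Set.univ ∧
          (∃ m : ℝ → ℝ, ∀ z ∈ W, ∀ b : Fin 3, b ≠ 2 →
            fderiv ℝ (v z.1) z.2 (EuclideanSpace.single 2 1) b =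
              m z.1 * fderiv ℝ (v z.1) z.2 (EuclideanSpace.single b 1) 2)) ∨
        (∃ s : ℝ, s < 0 ∧ ∃ U : Set (EuclideanSpace ℝ (Fin 3)), IsOpen U ∧ U.Nonempty ∧
          ((∀ y ∈ U, Literature.Analysis.FluidPDE.curl (v s) y = 0) ∨
           (∀ y ∈ U, fderiv ℝ (v s) y (EuclideanSpace.single 0 1) 2 = 0 ∧ fderiv ℝ (v s) y (EuclideanSpace.single 1 1) 2 = 0) ∨
           (∀ y ∈ U, fderiv ℝ (v s) y (EuclideanSpace.single 2 1) 0 = 0 ∧ fderiv ℝ (v s) y (EuclideanSpace.single 2 1) 1 = 0))) :=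
  Summit.NavierStokesRegularity.NavierStokesRegularity.Theorems.PoloidalWindowDoorLrcModEntireThreadDichotomy.threadDichotomy

/-- **STUB S3 (RESEARCH, deciding): THE THREADED THICK COLUMN IS EMPTY.**  No profile of the route's Type-I class (rate, continuity,
Oseen-mild identity (M), divergence-free), poloidal along `e₃`, NORMALISED AT THE HOT SPOT (`√(−t)|v₂(t,x)| ≤ |v₂(−1,0)| ≠ 0` on the slab) and
THREADED there (`∇v₂(−1,0) = 0` — supplied free by the proved `threadPin_of_hotSpot`, kept explicit so provers see the pin), carries non-degenerate
twisting THICK windows accumulating at `(−1,0)`.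
Handles (card): the pinched-leaf Taylor hierarchy at the thread (structure functions at half rate), the closed-leaf disc moments with the
twist slack `J·T ≥ 𝒜_z²`, and every free pin of the hot spot (`∂_zv₂ = 0`, `v₂D²v₂ ≤ 0`, `∂ₜv₂ = v₂/2`, signed `∂_zp`).  (M) is load-bearing
(refuter1 K-48/K-50: the (M)-free thick kinematics is inhabited); the statement is about the THICK stratum only — every other stratum
reaching the hot spot is closed by the tree or by the shared (TH) stub (`poloidalLiouville_of_farThread`). -/
theorem stub_threadedThickEmpty :
    ∀ (C : ℝ) (v : ℝ → EuclideanSpace ℝ (Fin 3) → EuclideanSpace ℝ (Fin 3)),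
      Literature.Analysis.FluidPDE.HasTypeITimeDecay C v →
      ContinuousOn (Function.uncurry v) (Set.Iio (0 : ℝ) ×ˢ Set.univ) →
      (∀ s t : ℝ, s < t → t < 0 → ∀ x, v t x =
        Literature.Analysis.UnboundedOperators.heatExtension (v s) (t - s) x -
          Literature.Analysis.FluidPDE.oseenDuhamel 1 s v v t x) →
      (∀ t < 0, Literature.Analysis.FluidPDE.VectorCalculus.IsDivFree (v t)) →
      (∀ s < 0, ∀ y, ⟪Literature.Analysis.FluidPDE.curl (v s) y, EuclideanSpace.single 2 1⟫_ℝ = 0) →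
      v (-1) 0 2 ≠ 0 → (∀ t < 0, ∀ x, Real.sqrt (-t) * |v t x 2| ≤ |v (-1) 0 2|) →
      (∀ h : EuclideanSpace ℝ (Fin 3), fderiv ℝ (v (-1)) 0 h 2 = 0) →
      (deriv (fun s => v s 0 2) (-1) = v (-1) 0 2 / 2 ∧ v (-1) 0 2 * (Δ (fun y => v (-1) y 2)) 0 ≤ 0) →
      ∀ W : Set (ℝ × EuclideanSpace ℝ (Fin 3)), IsOpen W → W ⊆ Set.Iio (0 : ℝ) ×ˢ Set.univ →
        (∀ z ∈ W, (Literature.Analysis.FluidPDE.curl (v z.1) z.2 ≠ 0 ∧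
            (fderiv ℝ (v z.1) z.2 (EuclideanSpace.single 0 1) 2 ≠ 0 ∨ fderiv ℝ (v z.1) z.2 (EuclideanSpace.single 1 1) 2 ≠ 0) ∧
            (fderiv ℝ (v z.1) z.2 (EuclideanSpace.single 2 1) 0 ≠ 0 ∨ fderiv ℝ (v z.1) z.2 (EuclideanSpace.single 2 1) 1 ≠ 0)) ∧
          (fderiv ℝ (fun x => fderiv ℝ (v z.1) x (EuclideanSpace.single 2 1) 2) z.2 (EuclideanSpace.single 0 1) *
                fderiv ℝ (v z.1) z.2 (EuclideanSpace.single 1 1) 2 -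
              fderiv ℝ (fun x => fderiv ℝ (v z.1) x (EuclideanSpace.single 2 1) 2) z.2 (EuclideanSpace.single 1 1) *
                fderiv ℝ (v z.1) z.2 (EuclideanSpace.single 0 1) 2 ≠ 0)) →
        (∀ m : ℝ → ℝ → ℝ, ∀ W₁ : Set (ℝ × EuclideanSpace ℝ (Fin 3)), W₁ ⊆ W → IsOpen W₁ → W₁.Nonempty →
            ∃ z ∈ W₁, ∃ b : Fin 3, b ≠ 2 ∧
              fderiv ℝ (v z.1) z.2 (EuclideanSpace.single 2 1) b ≠
                m z.1 (z.2 2) * fderiv ℝ (v z.1) z.2 (EuclideanSpace.single b 1) 2) →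
        (∀ r : ℝ, 0 < r → (Metric.ball ((-1 : ℝ), (0 : EuclideanSpace ℝ (Fin 3))) r ∩ W).Nonempty) →
        False := by
  sorry

/-! ## The hot-spot pins and the thread are TREE THEOREMS (p631041 `…LrcModEntireThreadPins`: `threadTimePin`, `threadSpacePin`,
`threadSignedPin`, `threadPin_of_hotSpot`, relayed from this line's v4 text with author credit ns-idea-8 g2). -/

/-! ## Composition, step 1 (proved): the (TH) column in LIOUVILLE currency from the shared local stub (= `twist_split` v4.3's chain) -/

/-- v4.1's local statement from the v4.3 stub (rotation/scaling gauge, Galilean frame and non-umbilic relocation are free: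
`…NormalFormRS.localTHEmptyHypNF_of_normalFormRS`, `…Galilean.localTHEmptyHypNonUmbilic_of_galilean`,
`…NonUmbilic.localTHEmptyHyp_of_localTHEmptyHypNonUmbilic`). -/
theorem localTHEmptyHyp_of_stubNUGRS :
    ∀ (u : ℝ → EuclideanSpace ℝ (Fin 3) → EuclideanSpace ℝ (Fin 3)) (μ A : ℝ → ℝ → ℝ)
      (U : Set (ℝ × EuclideanSpace ℝ (Fin 3))) (p₀ : ℝ × EuclideanSpace ℝ (Fin 3)),
      IsOpen U → p₀ ∈ U →
      AnalyticOnNhd ℝ (Function.uncurry u) U →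
      (∀ p ∈ U, AnalyticAt ℝ (Function.uncurry μ) (p.1, p.2 2)) →
      (∀ p ∈ U, AnalyticAt ℝ (Function.uncurry A) (p.1, p.2 2)) →
      (∀ p ∈ U, fderiv ℝ (u p.1) p.2 (EuclideanSpace.single 0 1) 1 = fderiv ℝ (u p.1) p.2 (EuclideanSpace.single 1 1) 0) →
      (∀ p ∈ U, fderiv ℝ (u p.1) p.2 (EuclideanSpace.single 0 1) 0 + fderiv ℝ (u p.1) p.2 (EuclideanSpace.single 1 1) 1 +
        fderiv ℝ (u p.1) p.2 (EuclideanSpace.single 2 1) 2 = 0) →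
      (∀ p ∈ U, ∀ b : Fin 3, b ≠ 2 →
        fderiv ℝ (u p.1) p.2 (EuclideanSpace.single 2 1) b =
          μ p.1 (p.2 2) * fderiv ℝ (u p.1) p.2 (EuclideanSpace.single b 1) 2) →
      (∀ p ∈ U,
        (1 - μ p.1 (p.2 2)) *
            (deriv (fun s => u s p.2 2) p.1 + fderiv ℝ (fun y => u p.1 y 2) p.2 (u p.1 p.2)
              - Δ (fun y => u p.1 y 2) p.2) =
          A p.1 (p.2 2) + (deriv (fun s => μ s (p.2 2)) p.1 - deriv (deriv (μ p.1)) (p.2 2)) * u p.1 p.2 2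
            + deriv (μ p.1) (p.2 2) / 2 * u p.1 p.2 2 ^ 2
            - 2 * deriv (μ p.1) (p.2 2) * fderiv ℝ (u p.1) p.2 (EuclideanSpace.single 2 1) 2) →
      fderiv ℝ (fun y => fderiv ℝ (u p₀.1) y (EuclideanSpace.single 2 1) 2) p₀.2 (EuclideanSpace.single 0 1) *
            fderiv ℝ (u p₀.1) p₀.2 (EuclideanSpace.single 1 1) 2 -
          fderiv ℝ (fun y => fderiv ℝ (u p₀.1) y (EuclideanSpace.single 2 1) 2) p₀.2 (EuclideanSpace.single 1 1) *
            fderiv ℝ (u p₀.1) p₀.2 (EuclideanSpace.single 0 1) 2 ≠ 0 →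
      μ p₀.1 (p₀.2 2) ≠ 0 → μ p₀.1 (p₀.2 2) ≠ 1 → deriv (μ p₀.1) (p₀.2 2) ≠ 0 →
      μ p₀.1 (p₀.2 2) < 0 → False :=
  localTHEmptyHyp_of_localTHEmptyHypNonUmbilic (localTHEmptyHypNonUmbilic_of_galilean
    (localTHEmptyHypNF_of_normalFormRS stub_localTHEmptyHypNUGRS))

/-- **(TH)∩TWISTING ⇒ the germ trichotomy** — tree `…TwistingTHLocalHypGerm.stub_twistingTH_of_localEmptyHyp` fed with the local stub
(= `twist_split`'s `stub_twistingTH`, same term). -/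
theorem twistingTH_germ :
    ∀ (C : ℝ) (v : ℝ → EuclideanSpace ℝ (Fin 3) → EuclideanSpace ℝ (Fin 3)),
      Literature.Analysis.FluidPDE.HasTypeITimeDecay C v →
      ContinuousOn (Function.uncurry v) (Set.Iio (0 : ℝ) ×ˢ Set.univ) →
      (∀ s t : ℝ, s < t → t < 0 → ∀ x, v t x =
        Literature.Analysis.UnboundedOperators.heatExtension (v s) (t - s) x -
          Literature.Analysis.FluidPDE.oseenDuhamel 1 s v v t x) →
      (∀ t < 0, Literature.Analysis.FluidPDE.VectorCalculus.IsDivFree (v t)) →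
      (∀ s < 0, ∀ y, ⟪Literature.Analysis.FluidPDE.curl (v s) y, EuclideanSpace.single 2 1⟫_ℝ = 0) →
      ∀ W : Set (ℝ × EuclideanSpace ℝ (Fin 3)), IsOpen W → W.Nonempty → W ⊆ Set.Iio (0 : ℝ) ×ˢ Set.univ →
        (∀ z ∈ W, (Literature.Analysis.FluidPDE.curl (v z.1) z.2 ≠ 0 ∧
            (fderiv ℝ (v z.1) z.2 (EuclideanSpace.single 0 1) 2 ≠ 0 ∨ fderiv ℝ (v z.1) z.2 (EuclideanSpace.single 1 1) 2 ≠ 0) ∧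
            (fderiv ℝ (v z.1) z.2 (EuclideanSpace.single 2 1) 0 ≠ 0 ∨ fderiv ℝ (v z.1) z.2 (EuclideanSpace.single 2 1) 1 ≠ 0))) →
        (∀ m : ℝ → ℝ, ∀ W₁ : Set (ℝ × EuclideanSpace ℝ (Fin 3)), W₁ ⊆ W → IsOpen W₁ → W₁.Nonempty →
            ∃ z ∈ W₁, ∃ b : Fin 3, b ≠ 2 ∧
              fderiv ℝ (v z.1) z.2 (EuclideanSpace.single 2 1) b ≠
                m z.1 * fderiv ℝ (v z.1) z.2 (EuclideanSpace.single b 1) 2) →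
        (∀ z ∈ W, (fderiv ℝ (fun x => fderiv ℝ (v z.1) x (EuclideanSpace.single 2 1) 2) z.2 (EuclideanSpace.single 0 1) *
                fderiv ℝ (v z.1) z.2 (EuclideanSpace.single 1 1) 2 -
              fderiv ℝ (fun x => fderiv ℝ (v z.1) x (EuclideanSpace.single 2 1) 2) z.2 (EuclideanSpace.single 1 1) *
                fderiv ℝ (v z.1) z.2 (EuclideanSpace.single 0 1) 2 ≠ 0)) →
        (∃ m : ℝ → ℝ → ℝ, ∀ z ∈ W, ∀ b : Fin 3, b ≠ 2 →
            fderiv ℝ (v z.1) z.2 (EuclideanSpace.single 2 1) b =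
              m z.1 (z.2 2) * fderiv ℝ (v z.1) z.2 (EuclideanSpace.single b 1) 2) →
        ∃ s : ℝ, s < 0 ∧ ∃ U : Set (EuclideanSpace ℝ (Fin 3)), IsOpen U ∧ U.Nonempty ∧
          ((∃ e : EuclideanSpace ℝ (Fin 3), e ≠ 0 ∧
              ∀ y ∈ U, fderiv ℝ (Literature.Analysis.FluidPDE.curl (v s)) y e = 0) ∨
           (∃ c : EuclideanSpace ℝ (Fin 3), ∀ y ∈ U,
              Literature.Analysis.FluidPDE.rotGen (Literature.Analysis.FluidPDE.curl (v s) y) =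
                fderiv ℝ (Literature.Analysis.FluidPDE.curl (v s)) y (Literature.Analysis.FluidPDE.rotGen (y - c))) ∨
           (∃ w : EuclideanSpace ℝ (Fin 3) → EuclideanSpace ℝ (Fin 3), AnalyticOnNhd ℝ w Set.univ ∧
              ¬ BddAbove (Set.range fun y => ‖w y‖) ∧ ∀ y ∈ U, v s y = w y)) :=
  stub_twistingTH_of_localEmptyHyp localTHEmptyHyp_of_stubNUGRS

/-! ## Composition, step 2 (proved): the (TV) column in LIOUVILLE currency (tree) -/

/-- **Time-only slope on SOME window ⇒ `v ≡ 0`** — `…TimeShearPressure.timeShear_normalForm` + the slope dichotomy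
`…TimeShearLiminf.eq_zero_of_timeShear_liminf` / `…HorizontalFlatPast.eq_zero_of_timeShear_unbounded` (the `eq_zero` halves of
`…TimeShearClosed.nonflatLiouville_of_local_timeShear`). -/
theorem eq_zero_of_local_timeOnlySlope {C : ℝ} {v : ℝ → EuclideanSpace ℝ (Fin 3) → EuclideanSpace ℝ (Fin 3)}
    (hrate : Literature.Analysis.FluidPDE.HasTypeITimeDecay C v)
    (hcont : ContinuousOn (Function.uncurry v) (Set.Iio (0 : ℝ) ×ˢ Set.univ))
    (hmild : ∀ s t : ℝ, s < t → t < 0 → ∀ x, v t x =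
      Literature.Analysis.UnboundedOperators.heatExtension (v s) (t - s) x -
        Literature.Analysis.FluidPDE.oseenDuhamel 1 s v v t x)
    (hdiv : ∀ t < 0, Literature.Analysis.FluidPDE.VectorCalculus.IsDivFree (v t))
    (hpol : ∀ s < 0, ∀ y, ⟪Literature.Analysis.FluidPDE.curl (v s) y, EuclideanSpace.single 2 1⟫_ℝ = 0)
    {W : Set (ℝ × EuclideanSpace ℝ (Fin 3))} (hW : IsOpen W) (hWne : W.Nonempty) (hWs : W ⊆ Set.Iio (0 : ℝ) ×ˢ Set.univ)
    {m : ℝ → ℝ}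
    (h : ∀ z ∈ W, ∀ b : Fin 3, b ≠ 2 →
      fderiv ℝ (v z.1) z.2 (EuclideanSpace.single 2 1) b = m z.1 * fderiv ℝ (v z.1) z.2 (EuclideanSpace.single b 1) 2) :
    ∀ t < 0, ∀ x, v t x = 0 := by
  rcases timeShear_normalForm hrate hcont hmild hdiv hpol hW hWne hWs h with hzero | ⟨μ, hμneg, hμa, hslope⟩
  · exact hzero
  · by_cases hB : ∃ M : ℝ, ∀ T : ℝ, ∃ τ < T, -M ≤ μ τ
    · obtain ⟨M, hM⟩ := hB
      exact eq_zero_of_timeShear_liminf hrate hcont hmild hdiv hpol hμneg hslope hμa hM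
    · push Not at hB
      refine eq_zero_of_timeShear_unbounded hrate hcont hmild hdiv hpol hslope fun M => ?_
      obtain ⟨T, hT⟩ := hB M
      refine ⟨T, fun τ hτ => ?_⟩
      have h1 : μ τ < -M := hT τ hτ
      have h2 : M < -μ τ := by linarith
      exact h2.le.trans (neg_le_abs (μ τ))

/-! ## Composition, step 3 (proved): THE POLOIDAL LIOUVILLE THEOREM from the stubs -/

/-- **CLASS + POLOIDAL ⇒ `v ≡ 0`** (modulo `stub_extremalThread`, `stub_threadDichotomy`, `stub_threadedThickEmpty`, `stub_localTHEmptyHypNUGRS`).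
If `v₂ ≡ 0` the profile is horizontally flat (tree); otherwise recentre at the hot spot (S1), sort the hot spot (S2): the threaded thick case
is S3, the untwisted / (TH) cases give a vorticity germ hence `v' ≡ 0` (tree + shared stub), the time-only and degenerate cases give `v' ≡ 0`
(tree) — all contradicting `v'₂(−1,0) ≠ 0`. -/
theorem poloidalLiouville_of_farThread :
    ∀ (C : ℝ) (v : ℝ → EuclideanSpace ℝ (Fin 3) → EuclideanSpace ℝ (Fin 3)),
      Literature.Analysis.FluidPDE.HasTypeITimeDecay C v →
      ContinuousOn (Function.uncurry v) (Set.Iio (0 : ℝ) ×ˢ Set.univ) →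
      (∀ s t : ℝ, s < t → t < 0 → ∀ x, v t x =
        Literature.Analysis.UnboundedOperators.heatExtension (v s) (t - s) x -
          Literature.Analysis.FluidPDE.oseenDuhamel 1 s v v t x) →
      (∀ t < 0, Literature.Analysis.FluidPDE.VectorCalculus.IsDivFree (v t)) →
      (∀ s < 0, ∀ y, ⟪Literature.Analysis.FluidPDE.curl (v s) y, EuclideanSpace.single 2 1⟫_ℝ = 0) →
      ∀ t < 0, ∀ x, v t x = 0 := by
  intro C v hrate hcont hmild hdiv hpol
  by_cases hv2 : ∀ t < 0, ∀ y : EuclideanSpace ℝ (Fin 3), v t y 2 = 0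
  · -- `v₂ ≡ 0`: the slice `−1` is horizontally flat
    have hs : (-1 : ℝ) < 0 := by norm_num
    have hA : AnalyticOnNhd ℝ (v (-1)) Set.univ := analyticOnNhd_slice hcont (bdd_of_hasTypeITimeDecay hrate) hmild hs
    refine eq_zero_of_horizontalGradient_eq_zero_on_open hrate hcont hmild hdiv hs (hpol (-1) hs) isOpen_univ Set.univ_nonempty ?_
    intro y _
    have hd : DifferentiableAt ℝ (v (-1)) y := (hA y (Set.mem_univ _)).differentiableAt
    have hfun : (fun z => v (-1) z 2) = fun _ => (0 : ℝ) := funext fun z => hv2 (-1) hs z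
    have h1 : fderiv ℝ (fun z => v (-1) z 2) y (EuclideanSpace.single 0 1) = 0 := by
      rw [hfun]; simp
    rw [fderiv_apply_coord (v (-1)) hd] at h1
    exact h1
  · push Not at hv2
    obtain ⟨t₀, ht₀, y₀, hy₀⟩ := hv2
    exfalso
    obtain ⟨v', hrate', hcont', hmild', hdiv', hpol', hne, hhot⟩ :=
      stub_extremalThread C v hrate hcont hmild hdiv hpol ⟨t₀, ht₀, y₀, hy₀⟩
    have hs : (-1 : ℝ) < 0 := by norm_num
    -- `v' ≡ 0` is absurd
    have habs : ¬ (∀ t < 0, ∀ x, v' t x = 0) := fun h0 => hne (by rw [h0 (-1) hs 0]; rfl)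
    -- germ ⇒ absurd
    have hgermAbs : ∀ (W : Set (ℝ × EuclideanSpace ℝ (Fin 3))), W.Nonempty → W ⊆ Set.Iio (0 : ℝ) ×ˢ Set.univ →
        (∀ z ∈ W, Literature.Analysis.FluidPDE.curl (v' z.1) z.2 ≠ 0 ∧
            (fderiv ℝ (v' z.1) z.2 (EuclideanSpace.single 0 1) 2 ≠ 0 ∨ fderiv ℝ (v' z.1) z.2 (EuclideanSpace.single 1 1) 2 ≠ 0) ∧
            (fderiv ℝ (v' z.1) z.2 (EuclideanSpace.single 2 1) 0 ≠ 0 ∨ fderiv ℝ (v' z.1) z.2 (EuclideanSpace.single 2 1) 1 ≠ 0)) →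
        (∃ s : ℝ, s < 0 ∧ ∃ U : Set (EuclideanSpace ℝ (Fin 3)), IsOpen U ∧ U.Nonempty ∧
          ((∃ e : EuclideanSpace ℝ (Fin 3), e ≠ 0 ∧
              ∀ y ∈ U, fderiv ℝ (Literature.Analysis.FluidPDE.curl (v' s)) y e = 0) ∨
           (∃ c : EuclideanSpace ℝ (Fin 3), ∀ y ∈ U,
              Literature.Analysis.FluidPDE.rotGen (Literature.Analysis.FluidPDE.curl (v' s) y) =
                fderiv ℝ (Literature.Analysis.FluidPDE.curl (v' s)) y (Literature.Analysis.FluidPDE.rotGen (y - c))) ∨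
           (∃ w : EuclideanSpace ℝ (Fin 3) → EuclideanSpace ℝ (Fin 3), AnalyticOnNhd ℝ w Set.univ ∧
              ¬ BddAbove (Set.range fun y => ‖w y‖) ∧ ∀ y ∈ U, v' s y = w y))) → False := by
      intro W hWne hWs hnd hgerm
      obtain ⟨z₀, hz₀⟩ := hWne
      obtain ⟨s, hs', U, hU, hUne, hg⟩ := hgerm
      exact false_of_germ_of_nondegenerate hrate' hcont' hmild' hdiv' hpol' (Set.mem_prod.1 (hWs hz₀)).1 (hnd z₀ hz₀).1
        hs' hU hUne hg
    have hsp := threadSignedPin C v' hrate' hcont' hmild' hdiv' hne hhot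
    rcases stub_threadDichotomy C v' hrate' hcont' hmild' hdiv' hpol' ((-1 : ℝ), (0 : EuclideanSpace ℝ (Fin 3))) hs with
      ⟨W, hW, hWs, hndtw, hthick, hacc⟩ | ⟨W, hW, hWne, hWs, hnd, htw0⟩ | ⟨W, hW, hWne, hWs, hnd, hpin, htw, hTH⟩ |
      ⟨W, hW, hWne, hWs, m, hm⟩ | ⟨s, hs', U, hU, hUne, hdeg⟩
    · -- (i) threaded thick: THIS LINE's stub
      exact stub_threadedThickEmpty C v' hrate' hcont' hmild' hdiv' hpol' hne hhot
        (threadPin_of_hotSpot hrate' hcont' hmild' hhot) hsp W hW hWs hndtw hthick hacc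
    · -- (ii) untwisted non-degenerate window: tree `stub_untwistedGerm`
      exact hgermAbs W hWne hWs hnd (stub_untwistedGerm C v' hrate' hcont' hmild' hdiv' hpol' W hW hWne hWs hnd htw0)
    · -- (iii) (TH) ∩ twisting: shared stub through the tree chain
      exact hgermAbs W hWne hWs hnd (twistingTH_germ C v' hrate' hcont' hmild' hdiv' hpol' W hW hWne hWs hnd hpin htw hTH)
    · -- (iv) time-only slope: (TV) is empty in Liouville currency
      exact habs (eq_zero_of_local_timeOnlySlope hrate' hcont' hmild' hdiv' hpol' hW hWne hWs hm)
    · -- (v) a degenerate open germ on one slice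
      rcases hdeg with hcurl | hflat | hrig
      · exact habs (eq_zero_of_curl_eq_zero_on_open hrate' hcont' hmild' hdiv' hs' hU hUne hcurl)
      · exact habs (eq_zero_of_horizontalGradient_eq_zero_on_open hrate' hcont' hmild' hdiv' hs' (hpol' s hs') hU hUne
          fun y hy => (hflat y hy).1)
      · exact habs (eq_zero_of_verticalShear_eq_zero_on_open hrate' hcont' hmild' hdiv' hs' hU hUne hrig)

/-! ## Composition, step 4 (proved): the cruxes BY NAME -/

/-- The slice-sharp residue shape of `…Sharper.poloidalWindowRigidity_of_sliceSharpNonflatLiouville` (all genericity hypotheses unused). -/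
theorem sliceSharpNonflatLiouville_of_farThread :
    ∀ (C : ℝ) (v : ℝ → EuclideanSpace ℝ (Fin 3) → EuclideanSpace ℝ (Fin 3)),
      Literature.Analysis.FluidPDE.HasTypeITimeDecay C v →
      ContinuousOn (Function.uncurry v) (Set.Iio (0 : ℝ) ×ˢ Set.univ) →
      (∀ s t : ℝ, s < t → t < 0 → ∀ x, v t x =
        Literature.Analysis.UnboundedOperators.heatExtension (v s) (t - s) x -
          Literature.Analysis.FluidPDE.oseenDuhamel 1 s v v t x) →
      (∀ t < 0, Literature.Analysis.FluidPDE.VectorCalculus.IsDivFree (v t)) →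
      (∀ s < 0, ∀ y, ⟪Literature.Analysis.FluidPDE.curl (v s) y, EuclideanSpace.single 2 1⟫_ℝ = 0) →
      (∀ s < 0, ∀ y, ⟪fderiv ℝ (v s) y (Literature.Analysis.FluidPDE.curl (v s) y), EuclideanSpace.single 2 1⟫_ℝ = 0) →
      (∀ s < 0, ∀ b : EuclideanSpace ℝ (Fin 3), b ≠ 0 → ∃ y,
        Literature.Analysis.FluidPDE.cross (Literature.Analysis.FluidPDE.curl (v s) y) b ≠ 0) →
      (∀ s < 0, ∃ y, fderiv ℝ (v s) y (EuclideanSpace.single 2 1) 0 ≠ 0 ∨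
        fderiv ℝ (v s) y (EuclideanSpace.single 2 1) 1 ≠ 0) →
      (∀ s < 0, ∀ a : EuclideanSpace ℝ (Fin 3), a ≠ 0 → ⟪a, EuclideanSpace.single 2 1⟫_ℝ = 0 →
        ∃ y, ⟪fderiv ℝ (v s) y a, EuclideanSpace.single 2 1⟫_ℝ ≠ 0) →
      (∀ s < 0, ∀ e : EuclideanSpace ℝ (Fin 3), e ≠ 0 → ∃ (y : EuclideanSpace ℝ (Fin 3)) (l : ℝ), v s (y + l • e) ≠ v s y) →
      (∀ s < 0, ∀ (L : EuclideanSpace ℝ (Fin 3) ≃ₗᵢ[ℝ] EuclideanSpace ℝ (Fin 3)) (c : EuclideanSpace ℝ (Fin 3)),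
        ¬ Literature.Analysis.FluidPDE.IsAxisymmetric (fun y => L.symm (v s (L y + c)))) →
      (∃ lam : ℝ, 0 < lam ∧ ∃ s < 0, ∃ y, lam • v (lam ^ 2 * s) (lam • y) ≠ v s y) →
        ¬ Literature.Analysis.FluidPDE.IsBackwardSingularPoint v 0 := by
  intro C v hrate hcont hmild hdiv hpol _ _ _ _ _ _ _
  exact not_backwardSingular_of_zero (poloidalLiouville_of_farThread C v hrate hcont hmild hdiv hpol)

/-- **COMPOSITION (proved): the crux `PoloidalWindowRigidity` (stmt-NavierStokesRegularity-19708) BY NAME** from `stub_extremalThread` (S1, provable),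
`stub_threadDichotomy` (S2, provable), `stub_threadedThickEmpty` (S3, deciding) and the shared `stub_localTHEmptyHypNUGRS` ((TH) column,
`twist_split` v4.3), via the landed reduction `…Sharper.poloidalWindowRigidity_of_sliceSharpNonflatLiouville`. -/
theorem PoloidalWindowRigidity_of_farThread :
    Summit.NavierStokesRegularity.NavierStokesRegularity.Theses.PoloidalWindowDoor.PoloidalWindowRigidity :=
  poloidalWindowRigidity_of_sliceSharpNonflatLiouville sliceSharpNonflatLiouville_of_farThread

/-- **COMPOSITION (proved): the promoted stub `LrcModEntire` (stmt-NavierStokesRegularity-20428) BY NAME** — a poloidal class profile is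
`≡ 0`, so a non-degenerate window is absurd. -/
theorem LrcModEntire_of_farThread :
    Summit.NavierStokesRegularity.NavierStokesRegularity.Theses.PoloidalWindowDoor.LrcModEntire := by
  intro C v hrate hcont hmild hdiv hpol W hW hWne hWs hnd hpin
  exfalso
  obtain ⟨z₀, hz₀⟩ := hWne
  have hzero := poloidalLiouville_of_farThread C v hrate hcont hmild hdiv hpol
  apply (hnd z₀ hz₀).1
  have hfun : v z₀.1 = fun _ => 0 := funext fun x => hzero z₀.1 (Set.mem_prod.1 (hWs hz₀)).1 x
  rw [hfun]
  simp [Literature.Analysis.FluidPDE.curl]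

end Summit.NavierStokesRegularity.NavierStokesRegularity.Cruxes.PoloidalWindowRigidity.FarThread
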